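import Summits.NavierStokesRegularity.FluidComputer.PalasekTowerFaceConstants
import Literature.Analysis.FluidPDE.ClassicalSolutionRescale

/-!
# The τ₁ faces of the register as universal Navier–Stokes constants, III: parabolic scale invariance
# of the two bound predicates (crux idea `universal-face-constants`, stmt-NavierStokesRegularity-19179)

Cell `ns-blowup`, seat `ns-palasek-19179-p2` (g2; holder of record of the crux `EpisodeBase` = `EpisodeBaseG` of the route
`PalasekTowerBreakdown`, item stmt-NavierStokesRegularity-19179, line `slot`). Sequel of `PalasekTowerFaceConstants.lean`.
The crux idea card `Cruxes/EpisodeBase/Ideas/universal-face-constants.md` (lens `dual`, 19179 evidence #53; critic #58: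
«Scale invariance of κ's arguments ✓ (u ↦ λu(λ²t, λx) at ν = 1 fixes TM², ‖∇u‖/M², ‖f‖/M³)») reads the faces of `EpisodeBaseG`
as values of two universal functions `κ(s, φ)`, `𝔄(s, c, φ)` of DIMENSIONLESS arguments. This file proves that reading in the
kernel: the hypothesis predicates `GradientProductionBound s φ κ` and `SpeedAmplificationBound s c φ a` (which quantify over
every start time `t₀`, window `T` and speed scale `M` with `T M² = s`) are EQUIVALENT to their unit-normalised forms
(`t₀ = 0`, `M = 1`, window `[0, s]`), by Leray's parabolic rescaling `u ↦ c u(t₀ + c² σ, c y)` with `c = M⁻¹` at fixed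
viscosity (`IsClassicalNSSolutionOn.nsRescale_translate`, the tree's discharge of Leray 1934 §20 / KNSS 2009 (6.2)):
energy stays finite (`lintegral_comp_space_affine`), forces scale by `c³`, speeds by `c`, gradients by `c²`
(`fderiv_stPull`). LABEL: E–C typing (KERNEL lemmas). WHAT THIS IS NOT: not Navier–Stokes evidence — nothing is asserted
about the values of `κ` or `𝔄`; the file only shows the predicates depend on `(s, φ)` resp. `(s, c, φ)` and the constant alone.

## Contents

* `GradientProductionBoundUnit s φ κ`, `SpeedAmplificationBoundUnit s c φ a` — the unit-normalised predicates;
* `gradientProductionBound_iff_unit`, `speedAmplificationBound_iff_unit` (for `0 < s`);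
* bookkeeping: `preimage_time_affine_Icc` (the rescaled clock maps `[0, s]` onto `[t₀, t₀ + T]`),
  `lintegral_enorm_sq_smul_stPull_le` (energy of the rescaled slice).

References: J. Leray, Acta Math. 63 (1934) §20 [cite: Leray1934, §20]; G. Koch, N. Nadirashvili, G. Seregin, V. Šverák,
Acta Math. 203 (2009) §6 (6.2) [cite: KochNadirashviliSereginSverak2009, §6 (6.2)]; S. Palasek, arXiv:2605.13827 §3.3
[cite: Palasek2026ElementaryModel, §3.3].
-/

noncomputable section

namespace Summit.NavierStokesRegularity.FluidComputer.PalasekTowerClayBridge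

open Set MeasureTheory Filter Topology Function
open scoped ENNReal ContDiff NNReal
open Literature.Analysis.FluidPDE

namespace UniversalFace

/-! ## §1 The unit-normalised predicates -/

/-- «κ(s, φ) ≤ κ», UNIT-NORMALISED: finite-energy classical forced NS at `ν = 1` on `[0, s] × ℝ³` with speed `≤ 1` and force
`≤ φ` has velocity gradient `≤ κ` at time `s`. Equivalent to `GradientProductionBound s φ κ` for `s > 0`
(`gradientProductionBound_iff_unit`). A HYPOTHESIS schema, nothing asserted. [cite: Seregin2014, Prop. 3.9] -/
@[conjecture] def GradientProductionBoundUnit (s φ κ : ℝ) : Prop :=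
  ∀ (f u : ℝ → EuclideanSpace ℝ (Fin 3) → EuclideanSpace ℝ (Fin 3)) (p : ℝ → EuclideanSpace ℝ (Fin 3) → ℝ),
    IsClassicalNSSolutionOn (Icc 0 s) 1 f u p →
    (∃ C : ℝ≥0∞, C < ⊤ ∧ ∀ t ∈ Icc 0 s, ∫⁻ x, ‖u t x‖ₑ ^ 2 ≤ C) →
    (∀ t ∈ Icc 0 s, ∀ x, ‖f t x‖ ≤ φ) →
    (∀ t ∈ Icc 0 s, ∀ x, ‖u t x‖ ≤ 1) →
    ∀ x, ‖fderiv ℝ (u s) x‖ ≤ κ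

/-- «𝔄(s, c, φ) ≤ a», UNIT-NORMALISED: finite-energy classical forced NS at `ν = 1` on `[0, s] × ℝ³` with speed `≤ 1` at
time `0`, running bound `≤ c` and force `≤ φ` has speed `≤ a` at time `s`. Equivalent to `SpeedAmplificationBound s c φ a`
for `s > 0` (`speedAmplificationBound_iff_unit`). A HYPOTHESIS schema, nothing asserted. [folklore] -/
@[conjecture] def SpeedAmplificationBoundUnit (s c φ a : ℝ) : Prop :=
  ∀ (f u : ℝ → EuclideanSpace ℝ (Fin 3) → EuclideanSpace ℝ (Fin 3)) (p : ℝ → EuclideanSpace ℝ (Fin 3) → ℝ),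
    IsClassicalNSSolutionOn (Icc 0 s) 1 f u p →
    (∃ C : ℝ≥0∞, C < ⊤ ∧ ∀ t ∈ Icc 0 s, ∫⁻ x, ‖u t x‖ₑ ^ 2 ≤ C) →
    (∀ t ∈ Icc 0 s, ∀ x, ‖f t x‖ ≤ φ) →
    (∀ x, ‖u 0 x‖ ≤ 1) →
    (∀ t ∈ Icc 0 s, ∀ x, ‖u t x‖ ≤ c) →
    ∀ x, ‖u s x‖ ≤ a

/-! ## §2 Bookkeeping for the parabolic rescaling `σ ↦ t₀ + c² σ`, `y ↦ c y` -/

/-- The rescaled clock `σ ↦ t₀ + c² σ` (`c > 0`, `c² s = T`) pulls the slab `[t₀, t₀ + T]` back to `[0, s]`. [folklore] -/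
theorem preimage_time_affine_Icc {t₀ T s c : ℝ} (hc : 0 < c) (hcs : c ^ 2 * s = T) :
    (fun r => t₀ + c ^ 2 * r) ⁻¹' Icc t₀ (t₀ + T) = Icc 0 s := by
  have hc2 : 0 < c ^ 2 := by positivity
  ext r
  simp only [mem_preimage, mem_Icc]
  constructor
  · rintro ⟨h1, h2⟩
    refine ⟨?_, ?_⟩
    · nlinarith
    · nlinarith
  · rintro ⟨h1, h2⟩
    refine ⟨?_, ?_⟩
    · nlinarith
    · nlinarith

/-- Membership form: for `σ ∈ [0, s]` the rescaled time `t₀ + c² σ` lies in `[t₀, t₀ + T]`. [folklore] -/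
theorem time_affine_mem_Icc {t₀ T s c : ℝ} (hc : 0 < c) (hcs : c ^ 2 * s = T) {σ : ℝ} (hσ : σ ∈ Icc 0 s) :
    t₀ + c ^ 2 * σ ∈ Icc t₀ (t₀ + T) := by
  have h : σ ∈ (fun r => t₀ + c ^ 2 * r) ⁻¹' Icc t₀ (t₀ + T) := by
    rw [preimage_time_affine_Icc hc hcs]; exact hσ
  exact h

/-- **Energy of a rescaled slice**: `∫ ‖c u(t, c y)‖² dy = c² (c³)⁻¹ ∫ ‖u(t, x)‖² dx`, in the inequality form the
predicates need (`lintegral_comp_space_affine`). [folklore] -/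
theorem lintegral_enorm_sq_smul_stPull_le {c : ℝ} (hc : 0 < c) (β t₀ : ℝ)
    (u : ℝ → EuclideanSpace ℝ (Fin 3) → EuclideanSpace ℝ (Fin 3)) (σ : ℝ) {C : ℝ≥0∞}
    (hC : ∫⁻ x, ‖u (t₀ + β * σ) x‖ₑ ^ 2 ≤ C) :
    ∫⁻ y, ‖(c • stPull β c t₀ (0 : EuclideanSpace ℝ (Fin 3)) u) σ y‖ₑ ^ 2 ≤
      ‖c‖ₑ ^ 2 * (ENNReal.ofReal (c ^ Module.finrank ℝ (EuclideanSpace ℝ (Fin 3)))⁻¹ * C) := by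
  have h1 : ∀ y, ‖(c • stPull β c t₀ (0 : EuclideanSpace ℝ (Fin 3)) u) σ y‖ₑ ^ 2 =
      ‖c‖ₑ ^ 2 * ‖u (t₀ + β * σ) ((0 : EuclideanSpace ℝ (Fin 3)) + c • y)‖ₑ ^ 2 := by
    intro y
    rw [smul_stPull_apply, enorm_smul, mul_pow]
  simp_rw [h1]
  rw [lintegral_const_mul' _ _ (by simp)]
  gcongr
  rw [lintegral_comp_space_affine hc (0 : EuclideanSpace ℝ (Fin 3)) (fun x => ‖u (t₀ + β * σ) x‖ₑ ^ 2)]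
  gcongr

/-! ## §3 The equivalences -/

/-- **`GradientProductionBound` is its unit-normalised form** (`s > 0`): «→» is the instance `t₀ = 0`, `T = s`, `M = 1`;
«←» rescales a slab `[t₀, t₀ + T]` at speed scale `M` to `[0, s]` at speed scale `1` by `u ↦ c u(t₀ + c² σ, c y)`,
`c = M⁻¹` (`IsClassicalNSSolutionOn.nsRescale_translate`; energy `lintegral_enorm_sq_smul_stPull_le`; forces `× c³`, speeds
`× c`, gradients `× c²` by `fderiv_stPull`). [cite: Leray1934, §20] -/
theorem gradientProductionBound_iff_unit {s φ κ : ℝ} (hs : 0 < s) :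
    GradientProductionBound s φ κ ↔ GradientProductionBoundUnit s φ κ := by
  constructor
  · intro h f u p hcl hen hfo hsp
    have key := h 0 s 1 f u p hs one_pos (by ring)
    simp only [zero_add, one_pow, mul_one] at key
    exact key hcl hen hfo hsp
  · intro h t₀ T M f u p hT hM hTM hcl hen hfo hsp x
    -- the rescaling parameter
    set c : ℝ := M⁻¹ with hcdef
    have hc : 0 < c := by positivity
    have hcM : c * M = 1 := by rw [hcdef]; field_simp
    have hcs : c ^ 2 * s = T := by
      rw [hcdef, ← hTM]; field_simp
    have hσT : t₀ + c ^ 2 * s = t₀ + T := by rw [hcs]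
    -- the rescaled classical solution on `[0, s]`
    have hresc := hcl.nsRescale_translate hc t₀ (0 : EuclideanSpace ℝ (Fin 3))
    rw [preimage_time_affine_Icc hc hcs] at hresc
    -- energy
    have hen' : ∃ C : ℝ≥0∞, C < ⊤ ∧ ∀ σ ∈ Icc 0 s,
        ∫⁻ y, ‖(c • stPull (c ^ 2) c t₀ (0 : EuclideanSpace ℝ (Fin 3)) u) σ y‖ₑ ^ 2 ≤ C := by
      obtain ⟨C, hC, hb⟩ := hen
      refine ⟨‖c‖ₑ ^ 2 * (ENNReal.ofReal (c ^ Module.finrank ℝ (EuclideanSpace ℝ (Fin 3)))⁻¹ * C), ?_, ?_⟩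
      · exact ENNReal.mul_lt_top (by simp) (ENNReal.mul_lt_top ENNReal.ofReal_lt_top hC)
      · intro σ hσ
        exact lintegral_enorm_sq_smul_stPull_le hc (c ^ 2) t₀ u σ (hb _ (time_affine_mem_Icc hc hcs hσ))
    -- force
    have hfo' : ∀ σ ∈ Icc 0 s, ∀ y,
        ‖((c ^ 2 * c) • stPull (c ^ 2) c t₀ (0 : EuclideanSpace ℝ (Fin 3)) f) σ y‖ ≤ φ := by
      intro σ hσ y
      rw [smul_stPull_apply, norm_smul, Real.norm_eq_abs, abs_of_pos (by positivity)]
      have h1 := hfo _ (time_affine_mem_Icc hc hcs hσ) ((0 : EuclideanSpace ℝ (Fin 3)) + c • y)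
      calc c ^ 2 * c * ‖f (t₀ + c ^ 2 * σ) (0 + c • y)‖ ≤ c ^ 2 * c * (φ * M ^ 3) :=
            mul_le_mul_of_nonneg_left h1 (by positivity)
        _ = φ * (c * M) ^ 3 := by ring
        _ = φ := by rw [hcM]; ring
    -- speed
    have hsp' : ∀ σ ∈ Icc 0 s, ∀ y,
        ‖(c • stPull (c ^ 2) c t₀ (0 : EuclideanSpace ℝ (Fin 3)) u) σ y‖ ≤ 1 := by
      intro σ hσ y
      rw [smul_stPull_apply, norm_smul, Real.norm_eq_abs, abs_of_pos hc]
      have h1 := hsp _ (time_affine_mem_Icc hc hcs hσ) ((0 : EuclideanSpace ℝ (Fin 3)) + c • y)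
      calc c * ‖u (t₀ + c ^ 2 * σ) (0 + c • y)‖ ≤ c * M := mul_le_mul_of_nonneg_left h1 hc.le
        _ = 1 := hcM
    -- the unit bound at the rescaled point `y = M x`
    have key := h _ _ _ hresc hen' hfo' hsp' (M • x)
    -- gradient of the rescaled slice at time `s`
    have hT' : t₀ + T ∈ Icc t₀ (t₀ + T) := ⟨by linarith, le_rfl⟩
    have hdiff : Differentiable ℝ (u (t₀ + c ^ 2 * s)) := by
      rw [hσT]; exact (hcl.contDiff_velocity hT').differentiable (by simp)
    have hd : DifferentiableAt ℝ (stPull (c ^ 2) c t₀ (0 : EuclideanSpace ℝ (Fin 3)) u s) (M • x) :=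
      differentiable_stPull_slice hdiff (M • x)
    have hfd : fderiv ℝ ((c • stPull (c ^ 2) c t₀ (0 : EuclideanSpace ℝ (Fin 3)) u) s) (M • x) =
        c • (c • fderiv ℝ (u (t₀ + T)) x) := by
      rw [show (c • stPull (c ^ 2) c t₀ (0 : EuclideanSpace ℝ (Fin 3)) u) s =
          c • (stPull (c ^ 2) c t₀ (0 : EuclideanSpace ℝ (Fin 3)) u s) from rfl,
        fderiv_const_smul hd, fderiv_stPull, hσT]
      congr 2
      rw [zero_add, smul_smul, hcM, one_smul]
    rw [hfd, norm_smul, norm_smul, Real.norm_eq_abs, abs_of_pos hc] at key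
    -- undo the scaling: `c² ‖∇u‖ ≤ κ` gives `‖∇u‖ ≤ κ M²`
    have hc2 : c * (c * ‖fderiv ℝ (u (t₀ + T)) x‖) * M ^ 2 ≤ κ * M ^ 2 :=
      mul_le_mul_of_nonneg_right key (by positivity)
    calc ‖fderiv ℝ (u (t₀ + T)) x‖ = c * (c * ‖fderiv ℝ (u (t₀ + T)) x‖) * M ^ 2 := by
          rw [show c * (c * ‖fderiv ℝ (u (t₀ + T)) x‖) * M ^ 2 = (c * M) ^ 2 * ‖fderiv ℝ (u (t₀ + T)) x‖ by ring,
            hcM, one_pow, one_mul]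
      _ ≤ κ * M ^ 2 := hc2

/-- **`SpeedAmplificationBound` is its unit-normalised form** (`s > 0`), by the same rescaling (speeds `× c`, the start
slice `σ = 0` is `t = t₀`). [cite: Leray1934, §20] -/
theorem speedAmplificationBound_iff_unit {s c₀ φ a : ℝ} (hs : 0 < s) :
    SpeedAmplificationBound s c₀ φ a ↔ SpeedAmplificationBoundUnit s c₀ φ a := by
  constructor
  · intro h f u p hcl hen hfo hst hrun
    have key := h 0 s 1 f u p hs one_pos (by ring)
    simp only [zero_add, one_pow, mul_one] at key
    exact key hcl hen hfo hst hrun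
  · intro h t₀ T m f u p hT hm hTm hcl hen hfo hst hrun x
    set c : ℝ := m⁻¹ with hcdef
    have hc : 0 < c := by positivity
    have hcm : c * m = 1 := by rw [hcdef]; field_simp
    have hcs : c ^ 2 * s = T := by
      rw [hcdef, ← hTm]; field_simp
    have hσT : t₀ + c ^ 2 * s = t₀ + T := by rw [hcs]
    have hresc := hcl.nsRescale_translate hc t₀ (0 : EuclideanSpace ℝ (Fin 3))
    rw [preimage_time_affine_Icc hc hcs] at hresc
    have hen' : ∃ C : ℝ≥0∞, C < ⊤ ∧ ∀ σ ∈ Icc 0 s,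
        ∫⁻ y, ‖(c • stPull (c ^ 2) c t₀ (0 : EuclideanSpace ℝ (Fin 3)) u) σ y‖ₑ ^ 2 ≤ C := by
      obtain ⟨C, hC, hb⟩ := hen
      refine ⟨‖c‖ₑ ^ 2 * (ENNReal.ofReal (c ^ Module.finrank ℝ (EuclideanSpace ℝ (Fin 3)))⁻¹ * C), ?_, ?_⟩
      · exact ENNReal.mul_lt_top (by simp) (ENNReal.mul_lt_top ENNReal.ofReal_lt_top hC)
      · intro σ hσ
        exact lintegral_enorm_sq_smul_stPull_le hc (c ^ 2) t₀ u σ (hb _ (time_affine_mem_Icc hc hcs hσ))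
    have hfo' : ∀ σ ∈ Icc 0 s, ∀ y,
        ‖((c ^ 2 * c) • stPull (c ^ 2) c t₀ (0 : EuclideanSpace ℝ (Fin 3)) f) σ y‖ ≤ φ := by
      intro σ hσ y
      rw [smul_stPull_apply, norm_smul, Real.norm_eq_abs, abs_of_pos (by positivity)]
      have h1 := hfo _ (time_affine_mem_Icc hc hcs hσ) ((0 : EuclideanSpace ℝ (Fin 3)) + c • y)
      calc c ^ 2 * c * ‖f (t₀ + c ^ 2 * σ) (0 + c • y)‖ ≤ c ^ 2 * c * (φ * m ^ 3) :=
            mul_le_mul_of_nonneg_left h1 (by positivity)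
        _ = φ * (c * m) ^ 3 := by ring
        _ = φ := by rw [hcm]; ring
    have hst' : ∀ y, ‖(c • stPull (c ^ 2) c t₀ (0 : EuclideanSpace ℝ (Fin 3)) u) 0 y‖ ≤ 1 := by
      intro y
      rw [smul_stPull_apply, norm_smul, Real.norm_eq_abs, abs_of_pos hc, mul_zero, add_zero]
      have h1 := hst ((0 : EuclideanSpace ℝ (Fin 3)) + c • y)
      calc c * ‖u t₀ (0 + c • y)‖ ≤ c * m := mul_le_mul_of_nonneg_left h1 hc.le
        _ = 1 := hcm
    have hrun' : ∀ σ ∈ Icc 0 s, ∀ y,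
        ‖(c • stPull (c ^ 2) c t₀ (0 : EuclideanSpace ℝ (Fin 3)) u) σ y‖ ≤ c₀ := by
      intro σ hσ y
      rw [smul_stPull_apply, norm_smul, Real.norm_eq_abs, abs_of_pos hc]
      have h1 := hrun _ (time_affine_mem_Icc hc hcs hσ) ((0 : EuclideanSpace ℝ (Fin 3)) + c • y)
      calc c * ‖u (t₀ + c ^ 2 * σ) (0 + c • y)‖ ≤ c * (c₀ * m) := mul_le_mul_of_nonneg_left h1 hc.le
        _ = c₀ * (c * m) := by ring
        _ = c₀ := by rw [hcm, mul_one]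
    have key := h _ _ _ hresc hen' hfo' hst' hrun' (m • x)
    rw [smul_stPull_apply, norm_smul, Real.norm_eq_abs, abs_of_pos hc, hσT, zero_add, smul_smul, hcm,
      one_smul] at key
    -- undo the scaling: `c ‖u‖ ≤ a` gives `‖u‖ ≤ a m`
    have h2 : c * ‖u (t₀ + T) x‖ * m ≤ a * m := mul_le_mul_of_nonneg_right key hm.le
    calc ‖u (t₀ + T) x‖ = c * ‖u (t₀ + T) x‖ * m := by
          rw [show c * ‖u (t₀ + T) x‖ * m = (c * m) * ‖u (t₀ + T) x‖ by ring, hcm, one_mul]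
      _ ≤ a * m := h2

end UniversalFace

end Summit.NavierStokesRegularity.FluidComputer.PalasekTowerClayBridge

end
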